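import Literature.Topology.FourManifolds.SurfaceGroupAmalgam
import Literature.AlgebraicTopology.FundamentalGroup.VanKampenClosedCoverPushout
import Literature.AlgebraicTopology.FundamentalGroup.BallWithArcsBasis
import HarnessLib

/-!
# The melon decomposition: `π₁` of a union of `g` one-holed tori glued cyclically along arcs is `S_g`

Topic `Literature/Topology/FourManifolds`; abstract Seifert–van Kampen assembly for the fact seat
`provefact-Literature.Topology.FourManifolds.exists-cbed50d78a` (named fact (g′)
`Literature.Topology.FourManifolds.exists_marking_centralSurface_of_gkTrisection`: the central
surface of a `(g, k)`-trisection is marked by the surface group `S_g`).  The explicit genus-`g`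
model surface of the seat (`FlowerHandlebody.lean` and sequels) is covered by `g` closed sectors
`S₀, …, S_{g-1}` ("melon slices"), consecutive ones meeting in a meridian arc `δ_k` from the north
pole `x₀` to the south pole `x₁`, all arcs meeting only in the poles; each sector is a one-holed
torus whose fundamental group at `x₀` has a free basis `a, b` in which the boundary loop
"down `δ_{k+1}`, up `δ_k`" reads `a b a⁻¹ b⁻¹`.  This file proves, from exactly such abstract
data in a Hausdorff space, that `π₁(S₀ ∪ … ∪ S_{g-1}, x₀) ≅ S_g`:

* `bdryClass S hx δ δ'` — the class `[δ' · δ⁻¹] ∈ π₁(S, x₀)` of two paths `δ, δ'` from `x₀` to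
  `x₁` inside `S`; `inclHomOfSubset_bdryClass`, `bdryClass_mul` (`[δ₁δ₀⁻¹]·[δ₂δ₁⁻¹] = [δ₂δ₀⁻¹]`,
  in Mathlib's convention `p * q = q.trans p`), `bdryClass_inv`;
* `exists_basis_union_of_arc` — gluing one more sector along a simply connected arc: free bases
  of `π₁(Y, x₀)` on `2n` letters and of `π₁(S, x₀)` on `2` letters give a free basis of
  `π₁(Y ∪ S, x₀)` on `2n + 2` letters extending both (van Kampen, free-product form,
  `VanKampen.exists_hom_of_closed_cover_collars_of_subsingleton` + `freeGroup_exists_mulEquiv_of_coproduct`);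
* `exists_surfaceGroup_mulEquiv_union_of_circle` — gluing the last sector along the circle
  `C = δ_{n+1} ∪ δ₀`: if the bases read the circle as `r_{n+1}` and `r₁⁻¹` then
  `π₁(Y ∪ S, x₀) ≅ S_{n+2}` (van Kampen, pushout form, `surfaceGroup_exists_mulEquiv_of_pushout_add`);
* `exists_surfaceGroup_mulEquiv_of_melon` — the induction over the slices, and
  `nonempty_surfaceGroup_mulEquiv_of_melon` — the same at every base point;
* `exists_surfaceGroup_mulEquiv_of_melon_values` — the same induction KEEPING THE GENERATOR VALUES:
  the isomorphism sends `a_k, b_k` to the images of the free basis `θ_k(a), θ_k(b)` of `π₁(S_k, x₀)`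
  (for computing the action of explicit self-maps of the melon on the marking).

Everything is proved; no named facts.  The hypotheses (closed pieces, open collars strong
deformation retracting onto the seams, path connectivity, simply connected arcs, injective arcs
meeting only at the poles) are the ones of the tree's closed-cover van Kampen theorems
(`VanKampenClosedCoverPushout.lean`) and of `exists_mulEquiv_int_apply_two_arcs`
(`BallWithArcsBasis.lean`).

## References

* A. Hatcher, *Algebraic Topology*, CUP (2002), §1.2: Thm. 1.20 (Seifert–van Kampen), Prop. 1.17,
  and p. 51 (`π₁(Σ_g) = S_g`). [HatcherAT2002]
* D. Gay, R. Kirby, *Trisecting 4-manifolds*, Geom. Topol. 20 (2016), Def. 1, Remark 2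
  ("the central genus `g` surface"). [GayKirby2016]
-/

noncomputable section

open Set Subgroup Function
open scoped unitInterval
open Literature.AlgebraicTopology.FundamentalGroup
open Literature.AlgebraicTopology.FundamentalGroup.VanKampen
open Literature.AlgebraicTopology.Homotopy

namespace Literature.Topology.FourManifolds

universe u

variable {X : Type u} [TopologicalSpace X]

/-! ### §1 Boundary classes -/

section Bdry

variable {x₀ x₁ : X}

/-- The loop `δ' · δ⁻¹` of two paths inside `S` stays inside `S`. [folklore] -/
theorem trans_symm_mem {S : Set X} {δ δ' : Path x₀ x₁} (hδ : ∀ t, δ t ∈ S) (hδ' : ∀ t, δ' t ∈ S)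
    (t : I) : (δ'.trans δ.symm) t ∈ S :=
  trans_mem hδ' (symm_mem hδ) t

/-- **The boundary class** `[δ' · δ⁻¹] ∈ π₁(S, x₀)` of two paths `δ, δ'` from `x₀` to `x₁` inside
`S` ("down `δ'`, back up `δ`"). [folklore] -/
def bdryClass (S : Set X) (hx : x₀ ∈ S) (δ δ' : Path x₀ x₁) (hδ : ∀ t, δ t ∈ S)
    (hδ' : ∀ t, δ' t ∈ S) : FundamentalGroup S ⟨x₀, hx⟩ :=
  FundamentalGroup.fromPath
    (Path.Homotopic.Quotient.mk (liftPath S (δ'.trans δ.symm) (trans_symm_mem hδ hδ')))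

/-- Boundary classes are natural under inclusions of subsets. [folklore] -/
theorem inclHomOfSubset_bdryClass {S S' : Set X} (h : S ⊆ S') (hx : x₀ ∈ S) (hx' : x₀ ∈ S')
    (δ δ' : Path x₀ x₁) (hδ : ∀ t, δ t ∈ S) (hδ' : ∀ t, δ' t ∈ S) :
    inclHomOfSubset h x₀ hx hx' (bdryClass S hx δ δ' hδ hδ') =
      bdryClass S' hx' δ δ' (fun t => h (hδ t)) (fun t => h (hδ' t)) :=
  inclHomOfSubset_fromPath_liftPath h hx hx' _ _

/-- **Boundary classes compose**: `[δ₁ δ₀⁻¹] · [δ₂ δ₁⁻¹] = [δ₂ δ₀⁻¹]` (Mathlib's fundamental group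
multiplies by `p * q = q.trans p`). [folklore] -/
theorem bdryClass_mul {S : Set X} (hx : x₀ ∈ S) (δ₀ δ₁ δ₂ : Path x₀ x₁) (h₀ : ∀ t, δ₀ t ∈ S)
    (h₁ : ∀ t, δ₁ t ∈ S) (h₂ : ∀ t, δ₂ t ∈ S) :
    bdryClass S hx δ₀ δ₁ h₀ h₁ * bdryClass S hx δ₁ δ₂ h₁ h₂ = bdryClass S hx δ₀ δ₂ h₀ h₂ := by
  unfold bdryClass
  rw [liftPath_trans S δ₁ δ₀.symm h₁ (symm_mem h₀), liftPath_trans S δ₂ δ₁.symm h₂ (symm_mem h₁),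
    liftPath_trans S δ₂ δ₀.symm h₂ (symm_mem h₀), liftPath_symm S δ₀ h₀, liftPath_symm S δ₁ h₁]
  simp only [FundamentalGroup.fromPath, FundamentalGroup.fromArrow, FundamentalGroup.mul_def,
    Path.Homotopic.Quotient.mk_trans, Path.Homotopic.Quotient.mk_symm,
    Path.Homotopic.Quotient.trans_assoc, symm_trans_cancel]

/-- **Boundary classes invert by swapping**: `[δ' δ⁻¹]⁻¹ = [δ δ'⁻¹]`. [folklore] -/
theorem bdryClass_inv {S : Set X} (hx : x₀ ∈ S) (δ δ' : Path x₀ x₁) (hδ : ∀ t, δ t ∈ S)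
    (hδ' : ∀ t, δ' t ∈ S) : (bdryClass S hx δ δ' hδ hδ')⁻¹ = bdryClass S hx δ' δ hδ' hδ := by
  unfold bdryClass
  rw [liftPath_trans S δ' δ.symm hδ' (symm_mem hδ), liftPath_trans S δ δ'.symm hδ (symm_mem hδ'),
    liftPath_symm S δ hδ, liftPath_symm S δ' hδ', FundamentalGroup.inv_def]
  simp only [FundamentalGroup.fromPath, FundamentalGroup.fromArrow]
  rw [← Path.Homotopic.Quotient.mk_symm, Path.trans_symm, Path.symm_symm]

end Bdry

/-! ### §2 Gluing one more sector along an arc -/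

/-- **Gluing along a simply connected arc** (van Kampen, free-product form).  `Y, S ⊆ X` closed,
meeting exactly in `R ∋ x₀`, `R` simply connected with open collars in `Y` and in `S` strong
deformation retracting onto it, `Y`, `S` path connected; free bases `Θ : F⟨a₁,…,b_n⟩ ≃* π₁(Y, x₀)`,
`θ : F⟨a, b⟩ ≃* π₁(S, x₀)`.  Then there is a free basis `e : F⟨a₁,…,b_{n+1}⟩ ≃* π₁(Y ∪ S, x₀)`
which is `Θ` on the first `n` handles and `θ` on the last.
[cite: HatcherAT2002, Thm. 1.20 and Prop. 1.17] -/
theorem exists_basis_union_of_arc {Y S R OY OS : Set X} {x₀ : X} {n : ℕ}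
    (hY : IsClosed Y) (hS : IsClosed S) (hRY : R ⊆ Y) (hRS : R ⊆ S) (hR : Y ∩ S ⊆ R)
    (hOY : IsOpen OY) (hROY : R ⊆ OY) (hsdrY : IsStrongDeformationRetractOf R (Y ∩ OY))
    (hOS : IsOpen OS) (hROS : R ⊆ OS) (hsdrS : IsStrongDeformationRetractOf R (S ∩ OS))
    (hYpc : IsPathConnected Y) (hSpc : IsPathConnected S) (hRsc : IsSimplyConnected R)
    (hx : x₀ ∈ R)
    (Θ : FreeGroup (surfaceGen n) ≃* FundamentalGroup Y ⟨x₀, hRY hx⟩)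
    (θ : FreeGroup (surfaceGen 1) ≃* FundamentalGroup S ⟨x₀, hRS hx⟩) :
    ∃ e : FreeGroup (surfaceGen (n + 1)) ≃* FundamentalGroup ↥(Y ∪ S) ⟨x₀, Or.inl (hRY hx)⟩,
      e.toMonoidHom.comp (genInclAdd n 1) =
          (inclHomOfSubset subset_union_left x₀ (hRY hx) (Or.inl (hRY hx))).comp Θ.toMonoidHom ∧
        e.toMonoidHom.comp (genShiftAdd n 1) =
          (inclHomOfSubset subset_union_right x₀ (hRS hx) (Or.inl (hRY hx))).comp θ.toMonoidHom := by
  haveI : Subsingleton (FundamentalGroup R ⟨x₀, hx⟩) := by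
    haveI : SimplyConnectedSpace R := hRsc
    infer_instance
  have hRpc : IsPathConnected R := hRsc.isPathConnected
  have hCY : R ⊆ Y ∩ OY := fun x h => ⟨hRY h, hROY h⟩
  have hCS : R ⊆ S ∩ OS := fun x h => ⟨hRS h, hROS h⟩
  refine freeGroup_exists_mulEquiv_of_coproduct _ _ ?_ ?_
  · -- existence (free-product form of van Kampen)
    let φ₁ : FundamentalGroup Y ⟨x₀, hRY hx⟩ →* FreeGroup (surfaceGen (n + 1)) :=
      (genInclAdd n 1).comp Θ.symm.toMonoidHom
    let φ₂ : FundamentalGroup S ⟨x₀, hRS hx⟩ →* FreeGroup (surfaceGen (n + 1)) :=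
      (genShiftAdd n 1).comp θ.symm.toMonoidHom
    obtain ⟨Φ, hΦ₁, hΦ₂⟩ := exists_hom_of_closed_cover_collars_of_subsingleton hY hS hRY hRS hR
      hOY rfl hCY hOS rfl hCS hsdrY hsdrS hYpc hSpc hRpc hx φ₁ φ₂
    refine ⟨Φ, ?_, ?_⟩
    · rw [← MonoidHom.comp_assoc, hΦ₁]
      exact MonoidHom.ext fun x => by simp [φ₁]
    · rw [← MonoidHom.comp_assoc, hΦ₂]
      exact MonoidHom.ext fun x => by simp [φ₂]
  · -- uniqueness
    intro F F' h₁ h₂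
    refine hom_ext_of_closed_cover_collars hY hS hRY hRS hR hOY rfl hCY hOS rfl hCS hsdrY hsdrS
      hYpc hSpc hRpc hx ?_ ?_
    · have hs : Function.Surjective Θ.toMonoidHom := Θ.surjective
      rw [← MonoidHom.cancel_right hs, MonoidHom.comp_assoc, MonoidHom.comp_assoc]
      exact h₁
    · have hs : Function.Surjective θ.toMonoidHom := θ.surjective
      rw [← MonoidHom.cancel_right hs, MonoidHom.comp_assoc, MonoidHom.comp_assoc]
      exact h₂

/-! ### §3 Gluing the last sector along a circle -/

/-- The reverse of an injective path is injective. [folklore] -/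
theorem injective_path_symm {x₀ x₁ : X} {δ : Path x₀ x₁} (h : Injective δ) : Injective δ.symm := by
  intro s t hst
  have : unitInterval.symm s = unitInterval.symm t := h hst
  simpa using congrArg unitInterval.symm this

/-- **Two injective arcs from `x₀` to `x₁` meeting only at their end points: the loop
"down `δ'`, up `δ`" generates `π₁` of their union.** [cite: HatcherAT2002, Thm. 1.7 (p. 29)] -/
theorem closure_bdryClass_eq_top [T2Space X] {x₀ x₁ : X} (δ δ' : Path x₀ x₁)
    (hδ : Injective δ) (hδ' : Injective δ')
    (hmeet : ∀ s t, δ' s = δ t → (s = 0 ∧ t = 0) ∨ (s = 1 ∧ t = 1))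
    (hx : x₀ ∈ range δ' ∪ range δ) (h₁ : ∀ t, δ t ∈ range δ' ∪ range δ)
    (h₂ : ∀ t, δ' t ∈ range δ' ∪ range δ) :
    Subgroup.closure {bdryClass (range δ' ∪ range δ) hx δ δ' h₁ h₂} = ⊤ := by
  have hmeet' : ∀ s t, δ' s = δ.symm t → (s = 0 ∧ t = 1) ∨ (s = 1 ∧ t = 0) := by
    intro s t hst
    rcases hmeet s (unitInterval.symm t) hst with ⟨hs, ht⟩ | ⟨hs, ht⟩
    · refine Or.inl ⟨hs, ?_⟩
      simpa using congrArg unitInterval.symm ht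
    · refine Or.inr ⟨hs, ?_⟩
      simpa using congrArg unitInterval.symm ht
  obtain ⟨e, he⟩ := exists_mulEquiv_int_apply_two_arcs δ' δ.symm hδ' (injective_path_symm hδ) hmeet'
  -- transport along the set equality `range δ' ∪ range δ⁻¹ = range δ' ∪ range δ`
  have hset : range δ' ∪ range δ.symm = range δ' ∪ range δ := by rw [Path.symm_range]
  set t₀ : FundamentalGroup ↥(range δ' ∪ range δ.symm) ⟨x₀, Or.inl ⟨0, δ'.source⟩⟩ :=
    FundamentalGroup.fromPath (Path.Homotopic.Quotient.mk
      (liftPath (range δ' ∪ range δ.symm) (δ'.trans δ.symm) (trans_mem_union_range δ' δ.symm))) with ht₀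
  have hbij := bijective_freeGroup_unit_lift_of_mulEquiv_apply t₀ e he
  have hgen₀ : Subgroup.closure {t₀} = ⊤ := by
    have hr : (FreeGroup.lift fun _ : Unit => t₀).range = ⊤ := MonoidHom.range_eq_top.2 hbij.2
    rwa [FreeGroup.range_lift_eq_closure, Set.range_const] at hr
  -- push through the (bijective) inclusion of equal sets
  set ι := inclHomOfSubset hset.le x₀ (Or.inl ⟨0, δ'.source⟩) hx with hι
  have hιb : Bijective ι := bijective_inclHomOfSubset_of_eq hset _ _
  have hιt : ι t₀ = bdryClass (range δ' ∪ range δ) hx δ δ' h₁ h₂ := by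
    rw [hι, ht₀, bdryClass]
    exact inclHomOfSubset_fromPath_liftPath hset.le _ hx _ _
  rw [← hιt, ← Set.image_singleton, ← MonoidHom.map_closure, hgen₀, ← MonoidHom.range_eq_map,
    MonoidHom.range_eq_top]
  exact hιb.2

/-- **Gluing the last sector along a circle** (van Kampen, pushout form).  `Y, S ⊆ X` closed,
meeting exactly in `C ∋ x₀` with open collars strong deformation retracting onto `C`, `Y`, `S`, `C`
path connected, `π₁(C, x₀)` generated by `t`; free bases `Θ : F⟨a₁,…,b_{n+1}⟩ ≃* π₁(Y, x₀)` with
`Θ(r_{n+1}) = t` and `θ : F⟨a, b⟩ ≃* π₁(S, x₀)` with `θ(r₁) = t⁻¹` (both read through the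
inclusions).  Then `π₁(Y ∪ S, x₀) ≅ S_{n+2}`, by an isomorphism which is `Θ` on the first `n + 1`
handles and `θ` on the last. [cite: HatcherAT2002, Thm. 1.20 and §1.2 p. 51] -/
theorem exists_surfaceGroup_mulEquiv_union_of_circle {Y S C OY OS : Set X} {x₀ : X} {n : ℕ}
    (hY : IsClosed Y) (hS : IsClosed S) (hCY : C ⊆ Y) (hCS : C ⊆ S) (hC : Y ∩ S ⊆ C)
    (hOY : IsOpen OY) (hCOY : C ⊆ OY) (hsdrY : IsStrongDeformationRetractOf C (Y ∩ OY))
    (hOS : IsOpen OS) (hCOS : C ⊆ OS) (hsdrS : IsStrongDeformationRetractOf C (S ∩ OS))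
    (hYpc : IsPathConnected Y) (hSpc : IsPathConnected S) (hCpc : IsPathConnected C)
    (hx : x₀ ∈ C) (t : FundamentalGroup C ⟨x₀, hx⟩) (ht : Subgroup.closure {t} = ⊤)
    (Θ : FreeGroup (surfaceGen (n + 1)) ≃* FundamentalGroup Y ⟨x₀, hCY hx⟩)
    (θ : FreeGroup (surfaceGen 1) ≃* FundamentalGroup S ⟨x₀, hCS hx⟩)
    (hΘ : Θ (surfaceRelator (n + 1)) = inclHomOfSubset hCY x₀ hx (hCY hx) t)
    (hθ : θ (surfaceRelator 1) = (inclHomOfSubset hCS x₀ hx (hCS hx) t)⁻¹) :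
    ∃ μ : SurfaceGroup (n + 1 + 1) ≃* FundamentalGroup ↥(Y ∪ S) ⟨x₀, Or.inl (hCY hx)⟩,
      μ.toMonoidHom.comp ((PresentedGroup.mk _).comp (genInclAdd (n + 1) 1)) =
          (inclHomOfSubset subset_union_left x₀ (hCY hx) (Or.inl (hCY hx))).comp Θ.toMonoidHom ∧
        μ.toMonoidHom.comp ((PresentedGroup.mk _).comp (genShiftAdd (n + 1) 1)) =
          (inclHomOfSubset subset_union_right x₀ (hCS hx) (Or.inl (hCY hx))).comp θ.toMonoidHom := by
  have hxY : x₀ ∈ Y := hCY hx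
  have hxS : x₀ ∈ S := hCS hx
  have hxW : x₀ ∈ Y ∪ S := Or.inl hxY
  have hCY' : C ⊆ Y ∩ OY := fun x h => ⟨hCY h, hCOY h⟩
  have hCS' : C ⊆ S ∩ OS := fun x h => ⟨hCS h, hCOS h⟩
  -- the two legs of the span, read in `π₁(Y ∪ S)`
  set u : FreeGroup (surfaceGen (n + 1)) →* FundamentalGroup ↥(Y ∪ S) ⟨x₀, hxW⟩ :=
    (inclHomOfSubset (subset_union_left : Y ⊆ Y ∪ S) x₀ hxY hxW).comp Θ.toMonoidHom with hu
  set v : FreeGroup (surfaceGen 1) →* FundamentalGroup ↥(Y ∪ S) ⟨x₀, hxW⟩ :=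
    (inclHomOfSubset (subset_union_right : S ⊆ Y ∪ S) x₀ hxS hxW).comp θ.toMonoidHom with hv
  -- the seam relation `u(r_{n+1}) · v(r₁) = 1`
  have huv : u (surfaceRelator (n + 1)) * v (surfaceRelator 1) = 1 := by
    rw [hu, hv, MonoidHom.comp_apply, MonoidHom.comp_apply, MulEquiv.coe_toMonoidHom,
      MulEquiv.coe_toMonoidHom, hΘ, hθ, map_inv,
      inclHomOfSubset_inclHomOfSubset hCY subset_union_left hx hxY hxW,
      inclHomOfSubset_inclHomOfSubset hCS subset_union_right hx hxS hxW, mul_inv_cancel]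
  -- the cone into `S_{n+2}`
  let φ₁ : FundamentalGroup Y ⟨x₀, hxY⟩ →* SurfaceGroup (n + 1 + 1) :=
    ((PresentedGroup.mk _).comp (genInclAdd (n + 1) 1)).comp Θ.symm.toMonoidHom
  let φ₂ : FundamentalGroup S ⟨x₀, hxS⟩ →* SurfaceGroup (n + 1 + 1) :=
    ((PresentedGroup.mk _).comp (genShiftAdd (n + 1) 1)).comp θ.symm.toMonoidHom
  have hφ₁ : φ₁.comp Θ.toMonoidHom = (PresentedGroup.mk _).comp (genInclAdd (n + 1) 1) :=
    MonoidHom.ext fun x => by simp [φ₁]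
  have hφ₂ : φ₂.comp θ.toMonoidHom = (PresentedGroup.mk _).comp (genShiftAdd (n + 1) 1) :=
    MonoidHom.ext fun x => by simp [φ₂]
  have compat : φ₁.comp (inclHomOfSubset hCY x₀ hx hxY) = φ₂.comp (inclHomOfSubset hCS x₀ hx hxS) := by
    refine MonoidHom.eq_of_eqOn_dense ht ?_
    intro s hs
    rw [Set.mem_singleton_iff] at hs
    subst hs
    have h1 : Θ.symm (inclHomOfSubset hCY x₀ hx hxY s) = surfaceRelator (n + 1) := by
      rw [MulEquiv.symm_apply_eq, hΘ]
    have h2 : θ.symm (inclHomOfSubset hCS x₀ hx hxS s) = (surfaceRelator 1)⁻¹ := by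
      rw [MulEquiv.symm_apply_eq, map_inv, hθ, inv_inv]
    change PresentedGroup.mk _ (genInclAdd (n + 1) 1 (Θ.symm (inclHomOfSubset hCY x₀ hx hxY s))) =
      PresentedGroup.mk _ (genShiftAdd (n + 1) 1 (θ.symm (inclHomOfSubset hCS x₀ hx hxS s)))
    rw [h1, h2, map_inv, map_inv, eq_inv_iff_mul_eq_one, ← map_mul, ← surfaceRelator_add]
    exact PresentedGroup.one_of_mem (Set.mem_singleton _)
  obtain ⟨Φ, ⟨hΦ₁, hΦ₂⟩, -⟩ := existsUnique_hom_of_closed_cover_collars hY hS hCY hCS hC hOY rfl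
    hCY' hOS rfl hCS' hsdrY hsdrS hYpc hSpc hCpc hx φ₁ φ₂ compat
  -- `S_{n+2}` is the pushout
  refine surfaceGroup_exists_mulEquiv_of_pushout_add u v huv ⟨Φ, ?_, ?_⟩ ?_
  · rw [hu, ← MonoidHom.comp_assoc, hΦ₁, hφ₁]
  · rw [hv, ← MonoidHom.comp_assoc, hΦ₂, hφ₂]
  · intro F F' hFu hFv
    have hΘs : Function.Surjective Θ.toMonoidHom := Θ.surjective
    have hθs : Function.Surjective θ.toMonoidHom := θ.surjective
    refine hom_ext_of_closed_cover_collars hY hS hCY hCS hC hOY rfl hCY' hOS rfl hCS' hsdrY hsdrS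
      hYpc hSpc hCpc hx ?_ ?_
    · rw [← MonoidHom.cancel_right hΘs, MonoidHom.comp_assoc, MonoidHom.comp_assoc]
      exact hFu
    · rw [← MonoidHom.cancel_right hθs, MonoidHom.comp_assoc, MonoidHom.comp_assoc]
      exact hFv

/-! ### §4 The melon theorem -/

omit [TopologicalSpace X] in
/-- `⋃ j ≤ 0, S j = S 0`. [folklore] -/
theorem biUnion_le_zero (S : ℕ → Set X) : ⋃ j ≤ 0, S j = S 0 := by
  ext x
  simp only [mem_iUnion, Nat.le_zero, exists_prop, exists_eq_left]

/-- **The melon theorem.**  Let `S₀, …, S_{n+1} ⊆ X` (a Hausdorff space) be closed path connected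
pieces and `δ₀, …, δ_{n+2} = δ₀` paths from `x₀` to `x₁` with `δ_k, δ_{k+1} ⊆ S_k`, such that

* for `1 ≤ k ≤ n`: `(S₀ ∪ … ∪ S_{k-1}) ∩ S_k ⊆ δ_k`, the arc `δ_k` is simply connected and has
  open collars in `S₀ ∪ … ∪ S_{k-1}` and in `S_k` strong deformation retracting onto it;
* `(S₀ ∪ … ∪ S_n) ∩ S_{n+1} ⊆ C := δ_{n+1} ∪ δ₀`, with open collars of `C` on both sides, and
  `δ_{n+1}`, `δ₀` injective, meeting only at the poles `x₀`, `x₁`;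
* each `π₁(S_k, x₀)` has a free basis `θ_k : F⟨a, b⟩ ≃* π₁(S_k, x₀)` reading the boundary:
  `θ_k(a b a⁻¹ b⁻¹) = [δ_{k+1} · δ_k⁻¹]`.

Then `π₁(S₀ ∪ … ∪ S_{n+1}, x₀) ≅ S_{n+2}` (and the union is path connected).  Proof: induction
over the slices with `exists_basis_union_of_arc`, keeping track of the boundary word
`Θ_k(r_{k+1}) = [δ_{k+1} · δ₀⁻¹]` via `bdryClass_mul`, and `exists_surfaceGroup_mulEquiv_union_of_circle`
for the last slice (`[δ_{n+1} · δ₀⁻¹]` generates `π₁(C)` by `closure_bdryClass_eq_top`).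
[cite: HatcherAT2002, Thm. 1.20 and §1.2 p. 51] -/
theorem exists_surfaceGroup_mulEquiv_of_melon [T2Space X] {n : ℕ} {x₀ x₁ : X}
    (S : ℕ → Set X) (δ : ℕ → Path x₀ x₁)
    (hScl : ∀ k ≤ n + 1, IsClosed (S k)) (hSpc : ∀ k ≤ n + 1, IsPathConnected (S k))
    (hδS : ∀ k ≤ n + 1, range (δ k) ⊆ S k) (hδS' : ∀ k ≤ n + 1, range (δ (k + 1)) ⊆ S k)
    (hδ : δ (n + 2) = δ 0)
    (hint : ∀ k, 1 ≤ k → k ≤ n → (⋃ j ≤ k - 1, S j) ∩ S k ⊆ range (δ k))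
    (hcolY : ∀ k, 1 ≤ k → k ≤ n → ∃ O, IsOpen O ∧ range (δ k) ⊆ O ∧
      IsStrongDeformationRetractOf (range (δ k)) ((⋃ j ≤ k - 1, S j) ∩ O))
    (hcolS : ∀ k, 1 ≤ k → k ≤ n → ∃ O, IsOpen O ∧ range (δ k) ⊆ O ∧
      IsStrongDeformationRetractOf (range (δ k)) (S k ∩ O))
    (hsc : ∀ k, 1 ≤ k → k ≤ n → IsSimplyConnected (range (δ k)))
    (hlast : (⋃ j ≤ n, S j) ∩ S (n + 1) ⊆ range (δ (n + 1)) ∪ range (δ 0))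
    (hcolY' : ∃ O, IsOpen O ∧ range (δ (n + 1)) ∪ range (δ 0) ⊆ O ∧
      IsStrongDeformationRetractOf (range (δ (n + 1)) ∪ range (δ 0)) ((⋃ j ≤ n, S j) ∩ O))
    (hcolS' : ∃ O, IsOpen O ∧ range (δ (n + 1)) ∪ range (δ 0) ⊆ O ∧
      IsStrongDeformationRetractOf (range (δ (n + 1)) ∪ range (δ 0)) (S (n + 1) ∩ O))
    (hinj₁ : Injective (δ (n + 1))) (hinj₀ : Injective (δ 0))
    (hmeet : ∀ s t, δ (n + 1) s = δ 0 t → (s = 0 ∧ t = 0) ∨ (s = 1 ∧ t = 1))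
    (θ : ∀ k (hk : k ≤ n + 1), FreeGroup (surfaceGen 1) ≃* FundamentalGroup (S k) ⟨x₀, hδS k hk ⟨0, (δ k).source⟩⟩)
    (hθ : ∀ k (hk : k ≤ n + 1), θ k hk (surfaceRelator 1) =
      bdryClass (S k) (hδS k hk ⟨0, (δ k).source⟩) (δ k) (δ (k + 1)) (fun t => hδS k hk ⟨t, rfl⟩)
        (fun t => hδS' k hk ⟨t, rfl⟩))
    (Z : Set X) (hZ : (⋃ j ≤ n + 1, S j) = Z) :
    IsPathConnected Z ∧ ∃ hxZ : x₀ ∈ Z, Nonempty (SurfaceGroup (n + 2) ≃* FundamentalGroup Z ⟨x₀, hxZ⟩) := by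
  -- the partial unions
  set Y : ℕ → Set X := fun k => ⋃ j ≤ k, S j with hYdef
  have hY0 : Y 0 = S 0 := biUnion_le_zero S
  have hYs : ∀ k, Y (k + 1) = Y k ∪ S (k + 1) := fun k => Set.biUnion_le_succ S k
  have hSY : ∀ {j k}, j ≤ k → S j ⊆ Y k := fun {j k} hjk x hx => mem_iUnion₂.2 ⟨j, hjk, hx⟩
  have hx0 : ∀ k ≤ n + 1, x₀ ∈ S k := fun k hk => hδS k hk ⟨0, (δ k).source⟩
  have hxY : ∀ k, x₀ ∈ Y k := fun k => hSY (Nat.zero_le k) (hx0 0 (Nat.zero_le _))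
  have h0Y : ∀ k, ∀ t, δ 0 t ∈ Y k := fun k t => hSY (Nat.zero_le k) (hδS 0 (Nat.zero_le _) ⟨t, rfl⟩)
  have hδY : ∀ k, k ≤ n + 1 → ∀ t, δ (k + 1) t ∈ Y k := fun k hk t => hSY le_rfl (hδS' k hk ⟨t, rfl⟩)
  -- induction over the arc steps
  have main : ∀ k (hk : k ≤ n), IsClosed (Y k) ∧ IsPathConnected (Y k) ∧
      ∃ Θ : FreeGroup (surfaceGen (k + 1)) ≃* FundamentalGroup (Y k) ⟨x₀, hxY k⟩,
        Θ (surfaceRelator (k + 1)) =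
          bdryClass (Y k) (hxY k) (δ 0) (δ (k + 1)) (h0Y k) (hδY k (hk.trans (Nat.le_succ n))) := by
    intro k
    induction k with
    | zero =>
      intro _
      refine ⟨hY0 ▸ hScl 0 (Nat.zero_le _), hY0 ▸ hSpc 0 (Nat.zero_le _), ?_⟩
      have hsub : S 0 ⊆ Y 0 := hY0.symm.le
      set ι := inclHomOfSubset hsub x₀ (hx0 0 (Nat.zero_le _)) (hxY 0) with hι
      have hιb : Bijective ι := bijective_inclHomOfSubset_of_eq hY0.symm _ _
      refine ⟨(θ 0 (Nat.zero_le _)).trans (MulEquiv.ofBijective ι hιb), ?_⟩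
      rw [MulEquiv.trans_apply, MulEquiv.ofBijective_apply, hθ 0 (Nat.zero_le _), hι,
        inclHomOfSubset_bdryClass]
    | succ k ih =>
      intro hk
      obtain ⟨hYcl, hYpc, Θ, hΘ⟩ := ih (Nat.le_of_succ_le hk)
      have hk1 : 1 ≤ k + 1 := Nat.succ_pos k
      have hkn : k + 1 ≤ n + 1 := hk.trans (Nat.le_succ n)
      -- the arc step data at index `k + 1`
      have hR : Y k ∩ S (k + 1) ⊆ range (δ (k + 1)) := by
        have := hint (k + 1) hk1 hk
        simpa using this
      obtain ⟨OY, hOY, hROY, hsdrY⟩ := hcolY (k + 1) hk1 hk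
      obtain ⟨OS, hOS, hROS, hsdrS⟩ := hcolS (k + 1) hk1 hk
      have hsdrY' : IsStrongDeformationRetractOf (range (δ (k + 1))) (Y k ∩ OY) := by simpa using hsdrY
      have hRY : range (δ (k + 1)) ⊆ Y k := fun x ⟨t, ht⟩ => ht ▸ hδY k (Nat.le_of_succ_le hkn) t
      have hRS : range (δ (k + 1)) ⊆ S (k + 1) := hδS (k + 1) hkn
      have hxR : x₀ ∈ range (δ (k + 1)) := ⟨0, (δ (k + 1)).source⟩
      obtain ⟨e, he₁, he₂⟩ := exists_basis_union_of_arc hYcl (hScl (k + 1) hkn) hRY hRS hR hOY hROY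
        hsdrY' hOS hROS hsdrS hYpc (hSpc (k + 1) hkn) (hsc (k + 1) hk1 hk) hxR Θ (θ (k + 1) hkn)
      -- transport to `Y (k + 1) = Y k ∪ S (k + 1)`
      have hsub : Y k ∪ S (k + 1) ⊆ Y (k + 1) := (hYs k).symm.le
      set ι := inclHomOfSubset hsub x₀ (Or.inl (hxY k)) (hxY (k + 1)) with hι
      have hιb : Bijective ι := bijective_inclHomOfSubset_of_eq (hYs k).symm _ _
      refine ⟨?_, ?_, e.trans (MulEquiv.ofBijective ι hιb), ?_⟩
      · rw [hYs k]; exact hYcl.union (hScl (k + 1) hkn)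
      · rw [hYs k]; exact hYpc.union (hSpc (k + 1) hkn) ⟨x₀, hxY k, hx0 (k + 1) hkn⟩
      -- the boundary word
      have hw : e (surfaceRelator (k + 1 + 1)) =
          bdryClass (Y k ∪ S (k + 1)) (Or.inl (hxY k)) (δ 0) (δ (k + 1 + 1))
            (fun t => Or.inl (h0Y k t)) (fun t => Or.inr (hδS' (k + 1) hkn ⟨t, rfl⟩)) := by
        rw [surfaceRelator_add (k + 1) 1, map_mul]
        have h1 : e (genInclAdd (k + 1) 1 (surfaceRelator (k + 1))) =
            inclHomOfSubset subset_union_left x₀ (hxY k) (Or.inl (hxY k)) (Θ (surfaceRelator (k + 1))) := by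
          have := DFunLike.congr_fun he₁ (surfaceRelator (k + 1))
          simpa using this
        have h2 : e (genShiftAdd (k + 1) 1 (surfaceRelator 1)) =
            inclHomOfSubset subset_union_right x₀ (hx0 (k + 1) hkn) (Or.inl (hxY k))
              (θ (k + 1) hkn (surfaceRelator 1)) := by
          have := DFunLike.congr_fun he₂ (surfaceRelator 1)
          simpa using this
        rw [h1, h2, hΘ, hθ (k + 1) hkn, inclHomOfSubset_bdryClass, inclHomOfSubset_bdryClass,
          bdryClass_mul]
      rw [MulEquiv.trans_apply, MulEquiv.ofBijective_apply, hw, hι, inclHomOfSubset_bdryClass]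
  -- the last step: glue `S (n + 1)` along the circle `C`
  obtain ⟨hYcl, hYpc, Θ, hΘ⟩ := main n le_rfl
  have hn1 : n + 1 ≤ n + 1 := le_rfl
  set C : Set X := range (δ (n + 1)) ∪ range (δ 0) with hCdef
  have hxC : x₀ ∈ C := Or.inr ⟨0, (δ 0).source⟩
  have hCY : C ⊆ Y n := union_subset (fun x ⟨t, ht⟩ => ht ▸ hδY n (Nat.le_succ n) t)
    (fun x ⟨t, ht⟩ => ht ▸ h0Y n t)
  have hCS : C ⊆ S (n + 1) := union_subset (hδS (n + 1) hn1) (by rw [← hδ]; exact hδS' (n + 1) hn1)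
  have hC : Y n ∩ S (n + 1) ⊆ C := hlast
  obtain ⟨OY, hOY, hCOY, hsdrY⟩ := hcolY'
  obtain ⟨OS, hOS, hCOS, hsdrS⟩ := hcolS'
  haveI : PathConnectedSpace I := isPathConnected_iff_pathConnectedSpace.1
    ((convex_Icc (0 : ℝ) 1).isPathConnected ⟨0, left_mem_Icc.2 zero_le_one⟩)
  have hCpc : IsPathConnected C :=
    (isPathConnected_range (δ (n + 1)).continuous).union (isPathConnected_range (δ 0).continuous)
      ⟨x₀, ⟨0, (δ (n + 1)).source⟩, ⟨0, (δ 0).source⟩⟩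
  have h1C : ∀ t, δ (n + 1) t ∈ C := fun t => Or.inl ⟨t, rfl⟩
  have h0C : ∀ t, δ 0 t ∈ C := fun t => Or.inr ⟨t, rfl⟩
  set t : FundamentalGroup C ⟨x₀, hxC⟩ := bdryClass C hxC (δ 0) (δ (n + 1)) h0C h1C with htdef
  have ht : Subgroup.closure {t} = ⊤ :=
    closure_bdryClass_eq_top (δ 0) (δ (n + 1)) hinj₀ hinj₁ hmeet hxC h0C h1C
  have hΘ' : Θ (surfaceRelator (n + 1)) = inclHomOfSubset hCY x₀ hxC (hxY n) t := by
    rw [hΘ, htdef, inclHomOfSubset_bdryClass]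
  have hθ' : θ (n + 1) hn1 (surfaceRelator 1) = (inclHomOfSubset hCS x₀ hxC (hx0 (n + 1) hn1) t)⁻¹ := by
    rw [hθ (n + 1) hn1, htdef, inclHomOfSubset_bdryClass, bdryClass_inv]
    -- `δ (n + 2) = δ 0`
    congr 1
  obtain ⟨μ, -, -⟩ := exists_surfaceGroup_mulEquiv_union_of_circle hYcl (hScl (n + 1) hn1) hCY hCS hC
    hOY hCOY hsdrY hOS hCOS hsdrS hYpc (hSpc (n + 1) hn1) hCpc hxC t ht Θ (θ (n + 1) hn1) hΘ' hθ'
  -- transport to `Z = Y n ∪ S (n + 1)`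
  have hZ' : Y n ∪ S (n + 1) = Z := by rw [← hYs n]; exact hZ
  subst hZ'
  refine ⟨hYpc.union (hSpc (n + 1) hn1) ⟨x₀, hxY n, hx0 (n + 1) hn1⟩, Or.inl (hxY n), ⟨μ⟩⟩


/-! ### §5 The melon theorem with generator values -/

/-- **The melon theorem, with the values of the isomorphism on the generators.**  Under the
hypotheses of `exists_surfaceGroup_mulEquiv_of_melon`, the isomorphism
`μ : S_{n+2} ≅ π₁(S₀ ∪ … ∪ S_{n+1}, x₀)` can be chosen so that the generators `a_k, b_k` of the
`k`-th handle go to the images, under the inclusion `S_k ⊆ ⋃ S_j`, of the free basis `θ_k(a), θ_k(b)`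
of `π₁(S_k, x₀)` (this is what the inductive construction does; the statement
`exists_surfaceGroup_mulEquiv_of_melon` only forgot it).  Needed to compute the action of explicit
self-maps of the melon (rotations, Dehn twists) on the marking.
[cite: HatcherAT2002, Thm. 1.20 and §1.2 p. 51] -/
theorem exists_surfaceGroup_mulEquiv_of_melon_values [T2Space X] {n : ℕ} {x₀ x₁ : X}
    (S : ℕ → Set X) (δ : ℕ → Path x₀ x₁)
    (hScl : ∀ k ≤ n + 1, IsClosed (S k)) (hSpc : ∀ k ≤ n + 1, IsPathConnected (S k))
    (hδS : ∀ k ≤ n + 1, range (δ k) ⊆ S k) (hδS' : ∀ k ≤ n + 1, range (δ (k + 1)) ⊆ S k)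
    (hδ : δ (n + 2) = δ 0)
    (hint : ∀ k, 1 ≤ k → k ≤ n → (⋃ j ≤ k - 1, S j) ∩ S k ⊆ range (δ k))
    (hcolY : ∀ k, 1 ≤ k → k ≤ n → ∃ O, IsOpen O ∧ range (δ k) ⊆ O ∧
      IsStrongDeformationRetractOf (range (δ k)) ((⋃ j ≤ k - 1, S j) ∩ O))
    (hcolS : ∀ k, 1 ≤ k → k ≤ n → ∃ O, IsOpen O ∧ range (δ k) ⊆ O ∧
      IsStrongDeformationRetractOf (range (δ k)) (S k ∩ O))
    (hsc : ∀ k, 1 ≤ k → k ≤ n → IsSimplyConnected (range (δ k)))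
    (hlast : (⋃ j ≤ n, S j) ∩ S (n + 1) ⊆ range (δ (n + 1)) ∪ range (δ 0))
    (hcolY' : ∃ O, IsOpen O ∧ range (δ (n + 1)) ∪ range (δ 0) ⊆ O ∧
      IsStrongDeformationRetractOf (range (δ (n + 1)) ∪ range (δ 0)) ((⋃ j ≤ n, S j) ∩ O))
    (hcolS' : ∃ O, IsOpen O ∧ range (δ (n + 1)) ∪ range (δ 0) ⊆ O ∧
      IsStrongDeformationRetractOf (range (δ (n + 1)) ∪ range (δ 0)) (S (n + 1) ∩ O))
    (hinj₁ : Injective (δ (n + 1))) (hinj₀ : Injective (δ 0))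
    (hmeet : ∀ s t, δ (n + 1) s = δ 0 t → (s = 0 ∧ t = 0) ∨ (s = 1 ∧ t = 1))
    (θ : ∀ k (hk : k ≤ n + 1), FreeGroup (surfaceGen 1) ≃* FundamentalGroup (S k) ⟨x₀, hδS k hk ⟨0, (δ k).source⟩⟩)
    (hθ : ∀ k (hk : k ≤ n + 1), θ k hk (surfaceRelator 1) =
      bdryClass (S k) (hδS k hk ⟨0, (δ k).source⟩) (δ k) (δ (k + 1)) (fun t => hδS k hk ⟨t, rfl⟩)
        (fun t => hδS' k hk ⟨t, rfl⟩)) :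
    ∃ (hxZ : x₀ ∈ ⋃ j ≤ n + 1, S j) (hSZ : ∀ k ≤ n + 1, S k ⊆ ⋃ j ≤ n + 1, S j)
      (μ : SurfaceGroup (n + 1 + 1) ≃* FundamentalGroup ↥(⋃ j ≤ n + 1, S j) ⟨x₀, hxZ⟩),
      ∀ k (hk : k ≤ n + 1) (c : Bool),
        μ (PresentedGroup.of ((⟨k, Nat.lt_succ_of_le hk⟩ : Fin (n + 1 + 1)), c)) =
          inclHomOfSubset (hSZ k hk) x₀ (hδS k hk ⟨0, (δ k).source⟩) hxZ
            (θ k hk (FreeGroup.of ((0 : Fin 1), c))) := by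
  -- the partial unions
  set Y : ℕ → Set X := fun k => ⋃ j ≤ k, S j with hYdef
  have hY0 : Y 0 = S 0 := biUnion_le_zero S
  have hYs : ∀ k, Y (k + 1) = Y k ∪ S (k + 1) := fun k => Set.biUnion_le_succ S k
  have hSY : ∀ {j k}, j ≤ k → S j ⊆ Y k := fun {j k} hjk x hx => mem_iUnion₂.2 ⟨j, hjk, hx⟩
  have hx0 : ∀ k ≤ n + 1, x₀ ∈ S k := fun k hk => hδS k hk ⟨0, (δ k).source⟩
  have hxY : ∀ k, x₀ ∈ Y k := fun k => hSY (Nat.zero_le k) (hx0 0 (Nat.zero_le _))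
  have h0Y : ∀ k, ∀ t, δ 0 t ∈ Y k := fun k t => hSY (Nat.zero_le k) (hδS 0 (Nat.zero_le _) ⟨t, rfl⟩)
  have hδY : ∀ k, k ≤ n + 1 → ∀ t, δ (k + 1) t ∈ Y k := fun k hk t => hSY le_rfl (hδS' k hk ⟨t, rfl⟩)
  -- induction over the arc steps, keeping the generator values
  have main : ∀ k (hk : k ≤ n), IsClosed (Y k) ∧ IsPathConnected (Y k) ∧
      ∃ Θ : FreeGroup (surfaceGen (k + 1)) ≃* FundamentalGroup (Y k) ⟨x₀, hxY k⟩,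
        Θ (surfaceRelator (k + 1)) =
          bdryClass (Y k) (hxY k) (δ 0) (δ (k + 1)) (h0Y k) (hδY k (hk.trans (Nat.le_succ n))) ∧
        ∀ j (hj : j ≤ k) (c : Bool),
          Θ (FreeGroup.of ((⟨j, Nat.lt_succ_of_le hj⟩ : Fin (k + 1)), c)) =
            inclHomOfSubset (hSY hj) x₀ (hx0 j (hj.trans (hk.trans (Nat.le_succ n)))) (hxY k)
              (θ j (hj.trans (hk.trans (Nat.le_succ n))) (FreeGroup.of ((0 : Fin 1), c))) := by
    intro k
    induction k with
    | zero =>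
      intro _
      refine ⟨hY0 ▸ hScl 0 (Nat.zero_le _), hY0 ▸ hSpc 0 (Nat.zero_le _), ?_⟩
      have hsub : S 0 ⊆ Y 0 := hY0.symm.le
      set ι := inclHomOfSubset hsub x₀ (hx0 0 (Nat.zero_le _)) (hxY 0) with hι
      have hιb : Bijective ι := bijective_inclHomOfSubset_of_eq hY0.symm _ _
      refine ⟨(θ 0 (Nat.zero_le _)).trans (MulEquiv.ofBijective ι hιb), ?_, fun j hj c => ?_⟩
      · rw [MulEquiv.trans_apply, MulEquiv.ofBijective_apply, hθ 0 (Nat.zero_le _), hι,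
          inclHomOfSubset_bdryClass]
      · obtain rfl : j = 0 := Nat.le_zero.1 hj
        rw [MulEquiv.trans_apply, MulEquiv.ofBijective_apply, hι]
        rfl
    | succ k ih =>
      intro hk
      obtain ⟨hYcl, hYpc, Θ, hΘ, hΘgen⟩ := ih (Nat.le_of_succ_le hk)
      have hk1 : 1 ≤ k + 1 := Nat.succ_pos k
      have hkn : k + 1 ≤ n + 1 := hk.trans (Nat.le_succ n)
      -- the arc step data at index `k + 1`
      have hR : Y k ∩ S (k + 1) ⊆ range (δ (k + 1)) := by
        have := hint (k + 1) hk1 hk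
        simpa using this
      obtain ⟨OY, hOY, hROY, hsdrY⟩ := hcolY (k + 1) hk1 hk
      obtain ⟨OS, hOS, hROS, hsdrS⟩ := hcolS (k + 1) hk1 hk
      have hsdrY' : IsStrongDeformationRetractOf (range (δ (k + 1))) (Y k ∩ OY) := by simpa using hsdrY
      have hRY : range (δ (k + 1)) ⊆ Y k := fun x ⟨t, ht⟩ => ht ▸ hδY k (Nat.le_of_succ_le hkn) t
      have hRS : range (δ (k + 1)) ⊆ S (k + 1) := hδS (k + 1) hkn
      have hxR : x₀ ∈ range (δ (k + 1)) := ⟨0, (δ (k + 1)).source⟩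
      obtain ⟨e, he₁, he₂⟩ := exists_basis_union_of_arc hYcl (hScl (k + 1) hkn) hRY hRS hR hOY hROY
        hsdrY' hOS hROS hsdrS hYpc (hSpc (k + 1) hkn) (hsc (k + 1) hk1 hk) hxR Θ (θ (k + 1) hkn)
      -- transport to `Y (k + 1) = Y k ∪ S (k + 1)`
      have hsub : Y k ∪ S (k + 1) ⊆ Y (k + 1) := (hYs k).symm.le
      set ι := inclHomOfSubset hsub x₀ (Or.inl (hxY k)) (hxY (k + 1)) with hι
      have hιb : Bijective ι := bijective_inclHomOfSubset_of_eq (hYs k).symm _ _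
      refine ⟨?_, ?_, e.trans (MulEquiv.ofBijective ι hιb), ?_, ?_⟩
      · rw [hYs k]; exact hYcl.union (hScl (k + 1) hkn)
      · rw [hYs k]; exact hYpc.union (hSpc (k + 1) hkn) ⟨x₀, hxY k, hx0 (k + 1) hkn⟩
      · -- the boundary word
        have hw : e (surfaceRelator (k + 1 + 1)) =
            bdryClass (Y k ∪ S (k + 1)) (Or.inl (hxY k)) (δ 0) (δ (k + 1 + 1))
              (fun t => Or.inl (h0Y k t)) (fun t => Or.inr (hδS' (k + 1) hkn ⟨t, rfl⟩)) := by
          rw [surfaceRelator_add (k + 1) 1, map_mul]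
          have h1 : e (genInclAdd (k + 1) 1 (surfaceRelator (k + 1))) =
              inclHomOfSubset subset_union_left x₀ (hxY k) (Or.inl (hxY k)) (Θ (surfaceRelator (k + 1))) := by
            have := DFunLike.congr_fun he₁ (surfaceRelator (k + 1))
            simpa using this
          have h2 : e (genShiftAdd (k + 1) 1 (surfaceRelator 1)) =
              inclHomOfSubset subset_union_right x₀ (hx0 (k + 1) hkn) (Or.inl (hxY k))
                (θ (k + 1) hkn (surfaceRelator 1)) := by
            have := DFunLike.congr_fun he₂ (surfaceRelator 1)
            simpa using this
          rw [h1, h2, hΘ, hθ (k + 1) hkn, inclHomOfSubset_bdryClass, inclHomOfSubset_bdryClass,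
            bdryClass_mul]
        rw [MulEquiv.trans_apply, MulEquiv.ofBijective_apply, hw, hι, inclHomOfSubset_bdryClass]
      · -- the generator values
        intro j hj c
        rw [MulEquiv.trans_apply, MulEquiv.ofBijective_apply, hι]
        rcases Nat.lt_or_ge j (k + 1) with hjk | hjk
        · have hj' : j ≤ k := Nat.lt_succ_iff.1 hjk
          have hgen : (FreeGroup.of ((⟨j, Nat.lt_succ_of_le hj⟩ : Fin (k + 1 + 1)), c) :
              FreeGroup (surfaceGen (k + 1 + 1))) =
              genInclAdd (k + 1) 1 (FreeGroup.of ((⟨j, Nat.lt_succ_of_le hj'⟩ : Fin (k + 1)), c)) := by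
            rw [genInclAdd_of]; rfl
          have h1 : e (genInclAdd (k + 1) 1 (FreeGroup.of ((⟨j, Nat.lt_succ_of_le hj'⟩ : Fin (k + 1)), c))) =
              inclHomOfSubset subset_union_left x₀ (hxY k) (Or.inl (hxY k))
                (Θ (FreeGroup.of ((⟨j, Nat.lt_succ_of_le hj'⟩ : Fin (k + 1)), c))) := by
            have := DFunLike.congr_fun he₁ (FreeGroup.of ((⟨j, Nat.lt_succ_of_le hj'⟩ : Fin (k + 1)), c))
            simpa using this
          rw [hgen, h1, hΘgen j hj' c, inclHomOfSubset_inclHomOfSubset, inclHomOfSubset_inclHomOfSubset]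
        · obtain rfl : j = k + 1 := le_antisymm hj hjk
          have hgen : (FreeGroup.of ((⟨k + 1, Nat.lt_succ_of_le hj⟩ : Fin (k + 1 + 1)), c) :
              FreeGroup (surfaceGen (k + 1 + 1))) =
              genShiftAdd (k + 1) 1 (FreeGroup.of ((0 : Fin 1), c)) := by
            rw [genShiftAdd_of]
            congr 2
          have h2 : e (genShiftAdd (k + 1) 1 (FreeGroup.of ((0 : Fin 1), c))) =
              inclHomOfSubset subset_union_right x₀ (hx0 (k + 1) hkn) (Or.inl (hxY k))
                (θ (k + 1) hkn (FreeGroup.of ((0 : Fin 1), c))) := by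
            have := DFunLike.congr_fun he₂ (FreeGroup.of ((0 : Fin 1), c))
            simpa using this
          rw [hgen, h2, inclHomOfSubset_inclHomOfSubset]
  -- the last step: glue `S (n + 1)` along the circle `C`
  obtain ⟨hYcl, hYpc, Θ, hΘ, hΘgen⟩ := main n le_rfl
  have hn1 : n + 1 ≤ n + 1 := le_rfl
  set C : Set X := range (δ (n + 1)) ∪ range (δ 0) with hCdef
  have hxC : x₀ ∈ C := Or.inr ⟨0, (δ 0).source⟩
  have hCY : C ⊆ Y n := union_subset (fun x ⟨t, ht⟩ => ht ▸ hδY n (Nat.le_succ n) t)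
    (fun x ⟨t, ht⟩ => ht ▸ h0Y n t)
  have hCS : C ⊆ S (n + 1) := union_subset (hδS (n + 1) hn1) (by rw [← hδ]; exact hδS' (n + 1) hn1)
  have hC : Y n ∩ S (n + 1) ⊆ C := hlast
  obtain ⟨OY, hOY, hCOY, hsdrY⟩ := hcolY'
  obtain ⟨OS, hOS, hCOS, hsdrS⟩ := hcolS'
  haveI : PathConnectedSpace I := isPathConnected_iff_pathConnectedSpace.1
    ((convex_Icc (0 : ℝ) 1).isPathConnected ⟨0, left_mem_Icc.2 zero_le_one⟩)
  have hCpc : IsPathConnected C :=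
    (isPathConnected_range (δ (n + 1)).continuous).union (isPathConnected_range (δ 0).continuous)
      ⟨x₀, ⟨0, (δ (n + 1)).source⟩, ⟨0, (δ 0).source⟩⟩
  have h1C : ∀ t, δ (n + 1) t ∈ C := fun t => Or.inl ⟨t, rfl⟩
  have h0C : ∀ t, δ 0 t ∈ C := fun t => Or.inr ⟨t, rfl⟩
  set t : FundamentalGroup C ⟨x₀, hxC⟩ := bdryClass C hxC (δ 0) (δ (n + 1)) h0C h1C with htdef
  have ht : Subgroup.closure {t} = ⊤ :=
    closure_bdryClass_eq_top (δ 0) (δ (n + 1)) hinj₀ hinj₁ hmeet hxC h0C h1C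
  have hΘ' : Θ (surfaceRelator (n + 1)) = inclHomOfSubset hCY x₀ hxC (hxY n) t := by
    rw [hΘ, htdef, inclHomOfSubset_bdryClass]
  have hθ' : θ (n + 1) hn1 (surfaceRelator 1) = (inclHomOfSubset hCS x₀ hxC (hx0 (n + 1) hn1) t)⁻¹ := by
    rw [hθ (n + 1) hn1, htdef, inclHomOfSubset_bdryClass, bdryClass_inv]
    -- `δ (n + 2) = δ 0`
    congr 1
  obtain ⟨μ, hμ₁, hμ₂⟩ := exists_surfaceGroup_mulEquiv_union_of_circle hYcl (hScl (n + 1) hn1) hCY hCS hC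
    hOY hCOY hsdrY hOS hCOS hsdrS hYpc (hSpc (n + 1) hn1) hCpc hxC t ht Θ (θ (n + 1) hn1) hΘ' hθ'
  -- transport to `Y (n + 1) = Y n ∪ S (n + 1)`
  have hZ : Y n ∪ S (n + 1) = Y (n + 1) := (hYs n).symm
  have hsub : Y n ∪ S (n + 1) ⊆ Y (n + 1) := hZ.le
  set ι := inclHomOfSubset hsub x₀ (Or.inl (hxY n)) (hxY (n + 1)) with hι
  have hιb : Bijective ι := bijective_inclHomOfSubset_of_eq hZ _ _
  refine ⟨hxY (n + 1), fun k hk => hSY hk, μ.trans (MulEquiv.ofBijective ι hιb), fun k hk c => ?_⟩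
  rw [MulEquiv.trans_apply, MulEquiv.ofBijective_apply, hι]
  rcases Nat.lt_or_ge k (n + 1) with hkn | hkn
  · have hk' : k ≤ n := Nat.lt_succ_iff.1 hkn
    have hgen : (PresentedGroup.of ((⟨k, Nat.lt_succ_of_le hk⟩ : Fin (n + 1 + 1)), c) :
        SurfaceGroup (n + 1 + 1)) =
        PresentedGroup.mk _ (genInclAdd (n + 1) 1 (FreeGroup.of ((⟨k, Nat.lt_succ_of_le hk'⟩ : Fin (n + 1)), c))) := by
      rw [genInclAdd_of]; rfl
    have h1 : μ (PresentedGroup.mk _ (genInclAdd (n + 1) 1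
        (FreeGroup.of ((⟨k, Nat.lt_succ_of_le hk'⟩ : Fin (n + 1)), c)))) =
        inclHomOfSubset subset_union_left x₀ (hxY n) (Or.inl (hxY n))
          (Θ (FreeGroup.of ((⟨k, Nat.lt_succ_of_le hk'⟩ : Fin (n + 1)), c))) := by
      have := DFunLike.congr_fun hμ₁ (FreeGroup.of ((⟨k, Nat.lt_succ_of_le hk'⟩ : Fin (n + 1)), c))
      simpa using this
    rw [hgen, h1, hΘgen k hk' c, inclHomOfSubset_inclHomOfSubset, inclHomOfSubset_inclHomOfSubset]
  · obtain rfl : k = n + 1 := le_antisymm hk hkn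
    have hgen : (PresentedGroup.of ((⟨n + 1, Nat.lt_succ_of_le hk⟩ : Fin (n + 1 + 1)), c) :
        SurfaceGroup (n + 1 + 1)) =
        PresentedGroup.mk _ (genShiftAdd (n + 1) 1 (FreeGroup.of ((0 : Fin 1), c))) := by
      rw [genShiftAdd_of]
      show PresentedGroup.of _ = PresentedGroup.of _
      congr 2
    have h2 : μ (PresentedGroup.mk _ (genShiftAdd (n + 1) 1 (FreeGroup.of ((0 : Fin 1), c)))) =
        inclHomOfSubset subset_union_right x₀ (hx0 (n + 1) hn1) (Or.inl (hxY n))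
          (θ (n + 1) hn1 (FreeGroup.of ((0 : Fin 1), c))) := by
      have := DFunLike.congr_fun hμ₂ (FreeGroup.of ((0 : Fin 1), c))
      simpa using this
    rw [hgen, h2, inclHomOfSubset_inclHomOfSubset]

/-- **The melon theorem at every base point**: under the hypotheses of
`exists_surfaceGroup_mulEquiv_of_melon`, `π₁(S₀ ∪ … ∪ S_{n+1}, z) ≅ S_{n+2}` for every `z` (the
union is path connected). [cite: HatcherAT2002, Thm. 1.20, Prop. 1.5 and §1.2 p. 51] -/
theorem nonempty_surfaceGroup_mulEquiv_of_melon [T2Space X] {n : ℕ} {x₀ x₁ : X}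
    (S : ℕ → Set X) (δ : ℕ → Path x₀ x₁)
    (hScl : ∀ k ≤ n + 1, IsClosed (S k)) (hSpc : ∀ k ≤ n + 1, IsPathConnected (S k))
    (hδS : ∀ k ≤ n + 1, range (δ k) ⊆ S k) (hδS' : ∀ k ≤ n + 1, range (δ (k + 1)) ⊆ S k)
    (hδ : δ (n + 2) = δ 0)
    (hint : ∀ k, 1 ≤ k → k ≤ n → (⋃ j ≤ k - 1, S j) ∩ S k ⊆ range (δ k))
    (hcolY : ∀ k, 1 ≤ k → k ≤ n → ∃ O, IsOpen O ∧ range (δ k) ⊆ O ∧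
      IsStrongDeformationRetractOf (range (δ k)) ((⋃ j ≤ k - 1, S j) ∩ O))
    (hcolS : ∀ k, 1 ≤ k → k ≤ n → ∃ O, IsOpen O ∧ range (δ k) ⊆ O ∧
      IsStrongDeformationRetractOf (range (δ k)) (S k ∩ O))
    (hsc : ∀ k, 1 ≤ k → k ≤ n → IsSimplyConnected (range (δ k)))
    (hlast : (⋃ j ≤ n, S j) ∩ S (n + 1) ⊆ range (δ (n + 1)) ∪ range (δ 0))
    (hcolY' : ∃ O, IsOpen O ∧ range (δ (n + 1)) ∪ range (δ 0) ⊆ O ∧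
      IsStrongDeformationRetractOf (range (δ (n + 1)) ∪ range (δ 0)) ((⋃ j ≤ n, S j) ∩ O))
    (hcolS' : ∃ O, IsOpen O ∧ range (δ (n + 1)) ∪ range (δ 0) ⊆ O ∧
      IsStrongDeformationRetractOf (range (δ (n + 1)) ∪ range (δ 0)) (S (n + 1) ∩ O))
    (hinj₁ : Injective (δ (n + 1))) (hinj₀ : Injective (δ 0))
    (hmeet : ∀ s t, δ (n + 1) s = δ 0 t → (s = 0 ∧ t = 0) ∨ (s = 1 ∧ t = 1))
    (θ : ∀ k (hk : k ≤ n + 1), FreeGroup (surfaceGen 1) ≃* FundamentalGroup (S k) ⟨x₀, hδS k hk ⟨0, (δ k).source⟩⟩)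
    (hθ : ∀ k (hk : k ≤ n + 1), θ k hk (surfaceRelator 1) =
      bdryClass (S k) (hδS k hk ⟨0, (δ k).source⟩) (δ k) (δ (k + 1)) (fun t => hδS k hk ⟨t, rfl⟩)
        (fun t => hδS' k hk ⟨t, rfl⟩))
    (Z : Set X) (hZ : (⋃ j ≤ n + 1, S j) = Z) (z : Z) :
    Nonempty (SurfaceGroup (n + 2) ≃* FundamentalGroup Z z) := by
  obtain ⟨hZpc, hxZ, ⟨μ⟩⟩ := exists_surfaceGroup_mulEquiv_of_melon S δ hScl hSpc hδS hδS' hδ hint hcolY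
    hcolS hsc hlast hcolY' hcolS' hinj₁ hinj₀ hmeet θ hθ Z hZ
  haveI : PathConnectedSpace Z := (isPathConnected_iff_pathConnectedSpace).1 hZpc
  exact ⟨μ.trans (FundamentalGroup.fundamentalGroupMulEquivOfPathConnected ⟨x₀, hxZ⟩ z)⟩

end Literature.Topology.FourManifolds
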